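import Summits.CriticalPhenomena.PercolationContinuityZ3.Theorems.PercNearOneGluingNoHeavyLowerTailQ44SingleSourceK1cLobe

/-!
# The cell-`ab|cy` handshake: one graph theorem behind the K2/K4s, K1/c-lobe and mixed residuals of the single-source packing

Support file for crux `stmt-CriticalPhenomena-4575` (master-family programme, row `Q44`, single-source packing
`g ≥ b1 + h_a`), seat `prim-bnk-1` gen 28; memo `run/shared/lean/prim/prim-l12/FROM-prim-bnk-1-gen28-DECISION-LIST.md` §2.

The SINGLE-SOURCE FAMILY at source `a` consists of the sides of the seven oriented types (cell ; co-cell)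
`Pb = (ab|c|y ; a|bcy) = (6,7)`, `Pc = (ac|b|y ; a|bcy) = (5,7)`, `K1[ab|cy] = (11,9)`, `K2[ab|cy] = (11,8)`, `K4[ab] = (6,8)`,
`K5[ab] = (6,1)`, `K4s[ay|bc] = (8,1)`.  Gen 27 proved odd targets for two residual shapes by the
handshake kernel with an `ab|cy`-base (`…Q44SingleSourceK2K4s`: K2 base against K2/K4s; `…Q44SingleSourceK1cLobe`: K1 base
against K1/`a→c`-lobes).  This file proves the common generalisation once, for ARBITRARY sub-families of the seven types:

**Theorem (`exists_odd_good_handshake11`).**  In a graph fibre let `𝒮` be a family of sides of single-source types, `X₀ ∈ 𝒮`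
a member of cell `ab|cy` contained in no other member, and suppose every member containing the `ab`-component `A₀` of
`X₀` (the edges of `X₀` whose endpoints are joined to `a` in `C ∪ X₀`) has cell `ab|cy`.  Then some good contains an odd
number of members of `𝒮`.  (Every kernel `A₀ ∪ (X₀ \ X)` has cells `(ab|c|y ; abcy)` — the `c–y` path of `X` avoids `A₀` —
and `(ab|c|y ; abcy)` is compatible with all seven types (`compat_six_fourteen`); parity = `exists_odd_good_of_handshake`.)

**Corollary (`exists_odd_good_PcK1K2K4s`).**  Every nonempty family of sides of types among
`{Pc, K1[ab|cy], K2[ab|cy], K4s[ay|bc]}` has an odd target in every graph fibre — containing both gen-27 residual theorems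
and the mixed shapes `{Pc,K1} + {K2,K4s}`, `{K1,K2,K4s}` of the gen-28 decision list (memo §1: branches 4c without K4,
and 5a).  What this theorem does NOT reach is recorded in the memo: members of cell `ab|c|y` (types `Pb, K4, K5`) containing
`A₀` (cores A and B of the decision list).  No sorries, no definitions, standard axioms.
-/

namespace Summit.CriticalPhenomena.PercolationContinuityZ3.Theorems

namespace TwoCopyMono

open Finset FourPointAtoms KernelPeeling Literature.Probability.Percolation

variable {n : ℕ}

/-! ## The seven oriented single-source types and their tables

The seven oriented (cell, co-cell) types of the single-source family at source `a` are written as the literal set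
`{(6,7), (5,7), (11,9), (11,8), (6,8), (6,1), (8,1)}` = `Pb, Pc, K1[ab|cy], K2[ab|cy], K4[ab], K5[ab], K4s[ay|bc]` throughout. -/

/-- Table: a kernel of cells `(ab|c|y ; abcy)` is compatible with every single-source type (`upAC h abcy` for every cell `h`,
and the co-cells `a|bcy, ac|by, ay|bc, a|b|cy` meet `ab|c|y` in `⊥`). [this work] -/
theorem compat_six_fourteen :
    ∀ q ∈ ({(6, 7), (5, 7), (11, 9), (11, 8), (6, 8), (6, 1), (8, 1)} : Finset (Fin 15 × Fin 15)),
      upAC q.1 14 = true ∧ downBot q.2 6 = true := by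
  decide +kernel

/-- Table: a single-source type of cell `ab|cy` has co-cell `ac|by` or `ay|bc` (types `K1[ab|cy]`, `K2[ab|cy]`). [this work] -/
theorem cocell_of_cell_eleven :
    ∀ q ∈ ({(6, 7), (5, 7), (11, 9), (11, 8), (6, 8), (6, 1), (8, 1)} : Finset (Fin 15 × Fin 15)),
      q.1 = 11 → q.2 = 9 ∨ q.2 = 8 := by
  decide +kernel

/-- Table fact: a cell above `ac|by` or above `ay|bc` joining `c–y` is `abcy`. [this work] -/
theorem cell_eq_fourteen_of_nine_or_eight (i l : Fin 15) (hl : l = 9 ∨ l = 8) (h1 : ple l i = true)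
    (h2 : pp i 2 3 = true) : i = 14 := by
  rcases hl with rfl | rfl
  · exact cell_eq_fourteen_of_acby i h1 h2
  · exact cell_eq_fourteen_of i h1 h2

/-- Table fact: the cells `ac|by` and `ay|bc` do not join `c–y`. [this work] -/
theorem pp_two_three_of_nine_or_eight (l : Fin 15) (hl : l = 9 ∨ l = 8) : pp l 2 3 = false := by
  rcases hl with rfl | rfl <;> decide

/-! ## The cell-`ab|cy` handshake theorem -/

/-- **The cell-`ab|cy` handshake (memo §2).**  Graph fibre `(M, C)` with labelling `ι`; `𝒮` a family of sides `S ⊆ M` of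
single-source types; `X₀ ∈ 𝒮` with `ι X₀ = ab|cy`, contained in no other member; every member containing the
`ab`-component of `X₀` has cell `ab|cy`.  Then some good of `κ T = ι (T ∩ M)` contains an odd number of members of `𝒮`.
[this work] -/
theorem exists_odd_good_handshake11 (a b c y : Fin n) (C M : Finset (Sym2 (Fin n)))
    (ι : Finset (Sym2 (Fin n)) → Fin 15) (hι : ∀ T : Finset (Sym2 (Fin n)), prof a b c y ↑(C ∪ T) = pp (ι T))
    (𝒮 : Finset (Finset (Sym2 (Fin n)))) (h𝒮M : ∀ S ∈ 𝒮, S ⊆ M)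
    (htypes : ∀ S ∈ 𝒮, (ι S, ι (M \ S)) ∈ ({(6, 7), (5, 7), (11, 9), (11, 8), (6, 8), (6, 1), (8, 1)} : Finset (Fin 15 × Fin 15)))
    (X₀ : Finset (Sym2 (Fin n))) (hX₀ : X₀ ∈ 𝒮) (hX₀c : ι X₀ = 11)
    (hmax : ∀ S ∈ 𝒮, X₀ ⊆ S → S = X₀)
    (h11 : ∀ X ∈ 𝒮, (∀ e ∈ X₀, (∀ v ∈ e, (openGraph (↑(C ∪ X₀) : Set (Sym2 (Fin n)))).Reachable a v) → e ∈ X) →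
      ι X = 11) :
    ∃ T ∈ goods (fun T : Finset (Sym2 (Fin n)) => ι (T ∩ M)), Odd #(𝒮.filter (fun S => S ⊆ T)) := by
  classical
  -- the cell map `κ T = ι (T ∩ M)` is monotone
  set κ : Finset (Sym2 (Fin n)) → Fin 15 := fun T => ι (T ∩ M) with hκ
  have hmono : ∀ A B : Finset (Sym2 (Fin n)), A ⊆ B → ple (κ A) (κ B) = true := fun A B hAB =>
    ple_fibreMap a b c y C ι hι (Finset.inter_subset_inter hAB (subset_refl M))
  have hκS : ∀ S, S ⊆ M → κ S = ι S := fun S hS => by simp only [hκ, Finset.inter_eq_left.2 hS]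
  have hκSc : ∀ S : Finset (Sym2 (Fin n)), κ Sᶜ = ι (M \ S) := fun S => by
    simp only [hκ]; congr 1; ext e; simp [Finset.mem_sdiff, Finset.mem_inter, and_comm]
  -- marked points
  have hq0 : quad a b c y 0 = a := rfl
  have hq1 : quad a b c y 1 = b := rfl
  have hq2 : quad a b c y 2 = c := rfl
  have hq3 : quad a b c y 3 = y := rfl
  have hreach : ∀ (T : Finset (Sym2 (Fin n))) (i j : Fin 4),
      (openGraph (↑(C ∪ T) : Set (Sym2 (Fin n)))).Reachable (quad a b c y i) (quad a b c y j) ↔ pp (ι T) i j = true :=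
    reachable_iff_pp a b c y C ι hι
  have hab_iff : ∀ T : Finset (Sym2 (Fin n)),
      (openGraph (↑(C ∪ T) : Set (Sym2 (Fin n)))).Reachable a b ↔ pp (ι T) 0 1 = true := fun T => by
    have h := hreach T 0 1; rwa [hq0, hq1] at h
  have hac_iff : ∀ T : Finset (Sym2 (Fin n)),
      (openGraph (↑(C ∪ T) : Set (Sym2 (Fin n)))).Reachable a c ↔ pp (ι T) 0 2 = true := fun T => by
    have h := hreach T 0 2; rwa [hq0, hq2] at h
  have hcy_iff : ∀ T : Finset (Sym2 (Fin n)),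
      (openGraph (↑(C ∪ T) : Set (Sym2 (Fin n)))).Reachable c y ↔ pp (ι T) 2 3 = true := fun T => by
    have h := hreach T 2 3; rwa [hq2, hq3] at h
  have hX₀M : X₀ ⊆ M := h𝒮M X₀ hX₀
  -- the co-cell of `X₀`
  have hX₀l : ι (M \ X₀) = 9 ∨ ι (M \ X₀) = 8 := by
    have h := cocell_of_cell_eleven (ι X₀, ι (M \ X₀)) (htypes X₀ hX₀) hX₀c
    exact h
  -- the `ab`-component of `X₀`
  set A₀ : Finset (Sym2 (Fin n)) :=
    X₀.filter (fun e => ∀ v, v ∈ e → (openGraph (↑(C ∪ X₀) : Set (Sym2 (Fin n)))).Reachable a v) with hA₀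
  have hA₀X₀ : A₀ ⊆ X₀ := Finset.filter_subset _ _
  have hA₀def : ∀ e ∈ X₀, (∀ v ∈ e, (openGraph (↑(C ∪ X₀) : Set (Sym2 (Fin n)))).Reachable a v) → e ∈ A₀ :=
    fun e he h => Finset.mem_filter.2 ⟨he, fun v hv => h v hv⟩
  have hA₀reach : ∀ e ∈ A₀, ∀ v ∈ e, (openGraph (↑(C ∪ A₀) : Set (Sym2 (Fin n)))).Reachable a v := by
    intro e he v hv
    have h := (Finset.mem_filter.1 he).2 v hv
    exact reachable_ab_of_component C X₀ A₀ a v hA₀def h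
  -- cells of `X₀`: a~b, a≁c in `C ∪ X₀`
  have hab₀ : (openGraph (↑(C ∪ X₀) : Set (Sym2 (Fin n)))).Reachable a b :=
    (hab_iff X₀).2 (by rw [hX₀c]; decide)
  have hac₀ : ¬ (openGraph (↑(C ∪ X₀) : Set (Sym2 (Fin n)))).Reachable a c := by
    intro h; have h' := (hac_iff X₀).1 h; rw [hX₀c] at h'; exact absurd h' (by decide)
  have habA : (openGraph (↑(C ∪ A₀) : Set (Sym2 (Fin n)))).Reachable a b :=
    reachable_ab_of_component C X₀ A₀ a b hA₀def hab₀
  -- a member containing `A₀` has cell `ab|cy` and co-cell `ac|by` or `ay|bc`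
  have h11' : ∀ X ∈ 𝒮, A₀ ⊆ X → ι X = 11 := by
    intro X hXS hAX
    exact h11 X hXS (fun e he h => hAX (hA₀def e he h))
  have hcol : ∀ X ∈ 𝒮, A₀ ⊆ X → ι (M \ X) = 9 ∨ ι (M \ X) = 8 := by
    intro X hXS hAX
    exact cocell_of_cell_eleven (ι X, ι (M \ X)) (htypes X hXS) (h11' X hXS hAX)
  -- the cells of the kernels `K = A₀ ∪ (X₀ \ X)`
  have hcells : ∀ X ∈ 𝒮, A₀ ⊆ X → κ (A₀ ∪ (X₀ \ X)) = 6 ∧ κ (A₀ ∪ (X₀ \ X))ᶜ = 14 := by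
    intro X hXS hAX
    have hXc : ι X = 11 := h11' X hXS hAX
    have hXl : ι (M \ X) = 9 ∨ ι (M \ X) = 8 := hcol X hXS hAX
    have hXM : X ⊆ M := h𝒮M X hXS
    set K : Finset (Sym2 (Fin n)) := A₀ ∪ (X₀ \ X) with hK
    have hKX₀ : K ⊆ X₀ := Finset.union_subset hA₀X₀ Finset.sdiff_subset
    have hKM : K ⊆ M := hKX₀.trans hX₀M
    constructor
    · -- `κ K = ab|c|y`
      rw [hκS K hKM]
      refine cell_eq_six_of (ι K) ?_ ?_ ?_
      · have h := hmono K X₀ hKX₀; rwa [hκS K hKM, hκS X₀ hX₀M, hX₀c] at h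
      · have h : (openGraph (↑(C ∪ K) : Set (Sym2 (Fin n)))).Reachable a b :=
          reachable_mono_finset (Finset.union_subset_union (subset_refl C) Finset.subset_union_left) habA
        exact (hab_iff K).1 h
      · have h : ¬ (openGraph (↑(C ∪ K) : Set (Sym2 (Fin n)))).Reachable c y := by
          refine not_reachable_cy_of_kernel C X₀ K (X₀ \ X) a c y hKX₀ ?_ hac₀ ?_
          · intro e he hnot
            rcases Finset.mem_union.1 he with heA | heD
            · exact absurd (Finset.mem_filter.1 heA).2 hnot
            · exact heD
          · intro hcy
            have h2 : (openGraph (↑(C ∪ (M \ X)) : Set (Sym2 (Fin n)))).Reachable c y :=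
              reachable_mono_finset (Finset.union_subset_union (subset_refl C)
                (Finset.sdiff_subset_sdiff hX₀M (subset_refl X))) hcy
            have h3 := (hcy_iff (M \ X)).1 h2
            rw [pp_two_three_of_nine_or_eight (ι (M \ X)) hXl] at h3
            exact absurd h3 (by decide)
        cases hpp : pp (ι K) 2 3
        · rfl
        · exact absurd ((hcy_iff K).2 hpp) h
    · -- `κ Kᶜ = abcy`
      rw [hκSc K]
      refine cell_eq_fourteen_of_nine_or_eight (ι (M \ K)) (ι (M \ X₀)) hX₀l ?_ ?_
      · have h := hmono X₀ᶜ Kᶜ (Finset.compl_subset_compl.2 hKX₀)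
        rwa [hκSc X₀, hκSc K] at h
      · have hcyX : (openGraph (↑(C ∪ X) : Set (Sym2 (Fin n)))).Reachable c y :=
          (hcy_iff X).2 (by rw [hXc]; decide)
        have hacX : ¬ (openGraph (↑(C ∪ X) : Set (Sym2 (Fin n)))).Reachable a c := by
          intro h; have h' := (hac_iff X).1 h; rw [hXc] at h'; exact absurd h' (by decide)
        have h1 := reachable_cy_avoid_component C X A₀ a c y hAX hA₀reach hcyX hacX
        have hsub : X \ A₀ ⊆ M \ K := by
          intro e he
          rw [Finset.mem_sdiff] at he ⊢
          refine ⟨hXM he.1, ?_⟩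
          intro heK
          rcases Finset.mem_union.1 heK with heA | heD
          · exact he.2 heA
          · exact (Finset.mem_sdiff.1 heD).2 he.1
        have h2 := reachable_mono_finset (Finset.union_subset_union (subset_refl C) hsub) h1
        exact (hcy_iff (M \ K)).1 h2
  -- the handshake kernel theorem
  refine exists_odd_good_of_handshake (goods κ) (goods_upper κ hmono) 𝒮 A₀ X₀ hX₀ hA₀X₀ hmax ?_
  intro X hXS hAX S hS
  obtain ⟨h6, h14⟩ := hcells X hXS hAX
  have hq := compat_six_fourteen (ι S, ι (M \ S)) (htypes S hS)
  refine union_compl_mem_goods_of_compatible κ hmono (subset_refl (A₀ ∪ (X₀ \ X))) ?_ ?_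
  · rw [h14, hκS S (h𝒮M S hS)]; exact hq.1
  · rw [h6, hκSc S]; exact hq.2

/-! ## Corollary: the types `Pc, K1[ab|cy], K2[ab|cy], K4s[ay|bc]` -/

/-- Table: the four types `Pc (5,7), K1[ab|cy] (11,9), K2[ab|cy] (11,8), K4s[ay|bc] (8,1)` are single-source types; the ones
without an `a–b` join are `Pc` and `K4s`; a `Pc`-kernel is compatible with `Pc` and `K4s`, a `K4s`-kernel with `K4s`; and
neither `Pc` nor `K4s` can contain a side of cell `ab|cy` or be contained across. [this work] -/
theorem tables_PcK1K2K4s :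
    (∀ q ∈ ({(5, 7), (11, 9), (11, 8), (8, 1)} : Finset (Fin 15 × Fin 15)),
        q ∈ ({(6, 7), (5, 7), (11, 9), (11, 8), (6, 8), (6, 1), (8, 1)} : Finset (Fin 15 × Fin 15))) ∧
    (∀ q ∈ ({(5, 7), (11, 9), (11, 8), (8, 1)} : Finset (Fin 15 × Fin 15)), pp q.1 0 1 = false → q = (5, 7) ∨ q = (8, 1)) ∧
    (∀ q ∈ ({(5, 7), (8, 1)} : Finset (Fin 15 × Fin 15)), upAC q.1 7 = true ∧ downBot q.2 5 = true) ∧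
    (upAC 8 1 = true ∧ downBot 1 8 = true) ∧
    (∀ q ∈ ({(5, 7), (8, 1)} : Finset (Fin 15 × Fin 15)), ple 5 q.1 = true → ple q.2 7 = true → q = (5, 7)) ∧
    (∀ q ∈ ({(5, 7), (11, 9), (11, 8), (8, 1)} : Finset (Fin 15 × Fin 15)), ple 11 q.1 = true → q.1 = 11) := by
  refine ⟨?_, ?_, ?_, ?_, ?_, ?_⟩ <;> decide +kernel

/-- **Odd targets for every family of `Pc / K1[ab|cy] / K2[ab|cy] / K4s[ay|bc]` sides** (memo §2; contains
`exists_odd_good_K2K4s` and `exists_odd_good_K1cLobe`).  If a member of cell `ab|cy` is present, a maximal-size one is the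
base of the cell-`ab|cy` handshake (members containing its `ab`-component join `a–b`, hence have cell `ab|cy`); otherwise a
`Pc`-member of maximal size, or failing that a `K4s`-member of maximal size, is a private compatible kernel. [this work] -/
theorem exists_odd_good_PcK1K2K4s (a b c y : Fin n) (C M : Finset (Sym2 (Fin n)))
    (ι : Finset (Sym2 (Fin n)) → Fin 15) (hι : ∀ T : Finset (Sym2 (Fin n)), prof a b c y ↑(C ∪ T) = pp (ι T))
    (𝒮 : Finset (Finset (Sym2 (Fin n)))) (hne : 𝒮.Nonempty) (h𝒮M : ∀ S ∈ 𝒮, S ⊆ M)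
    (htypes : ∀ S ∈ 𝒮, (ι S, ι (M \ S)) ∈ ({(5, 7), (11, 9), (11, 8), (8, 1)} : Finset (Fin 15 × Fin 15))) :
    ∃ T ∈ goods (fun T : Finset (Sym2 (Fin n)) => ι (T ∩ M)), Odd #(𝒮.filter (fun S => S ⊆ T)) := by
  classical
  set κ : Finset (Sym2 (Fin n)) → Fin 15 := fun T => ι (T ∩ M) with hκ
  have hmono : ∀ A B : Finset (Sym2 (Fin n)), A ⊆ B → ple (κ A) (κ B) = true := fun A B hAB =>
    ple_fibreMap a b c y C ι hι (Finset.inter_subset_inter hAB (subset_refl M))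
  have hκS : ∀ S, S ⊆ M → κ S = ι S := fun S hS => by simp only [hκ, Finset.inter_eq_left.2 hS]
  have hκSc : ∀ S : Finset (Sym2 (Fin n)), κ Sᶜ = ι (M \ S) := fun S => by
    simp only [hκ]; congr 1; ext e; simp [Finset.mem_sdiff, Finset.mem_inter, and_comm]
  have hq0 : quad a b c y 0 = a := rfl
  have hq1 : quad a b c y 1 = b := rfl
  have hab_iff : ∀ T : Finset (Sym2 (Fin n)),
      (openGraph (↑(C ∪ T) : Set (Sym2 (Fin n)))).Reachable a b ↔ pp (ι T) 0 1 = true := fun T => by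
    have h := reachable_iff_pp a b c y C ι hι T 0 1; rwa [hq0, hq1] at h
  obtain ⟨hT7, hTnoab, hTcompat, hT4s, hTcontPc, hT11⟩ := tables_PcK1K2K4s
  have htypes7 : ∀ S ∈ 𝒮, (ι S, ι (M \ S)) ∈
      ({(6, 7), (5, 7), (11, 9), (11, 8), (6, 8), (6, 1), (8, 1)} : Finset (Fin 15 × Fin 15)) :=
    fun S hS => hT7 _ (htypes S hS)
  by_cases hX : ∃ S ∈ 𝒮, ι S = 11
  · -- a cell-`ab|cy` member of maximal size is the base of the handshake
    obtain ⟨X₀, hX₀f, hX₀max⟩ := Finset.exists_max_image (𝒮.filter (fun S => ι S = 11)) Finset.card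
      (by obtain ⟨S, hS, hS'⟩ := hX; exact ⟨S, Finset.mem_filter.2 ⟨hS, hS'⟩⟩)
    have hX₀ : X₀ ∈ 𝒮 := (Finset.mem_filter.1 hX₀f).1
    have hX₀c : ι X₀ = 11 := (Finset.mem_filter.1 hX₀f).2
    have hX₀M : X₀ ⊆ M := h𝒮M X₀ hX₀
    -- members containing `X₀` have cell `ab|cy`, hence equal `X₀` by maximality
    have hmax : ∀ S ∈ 𝒮, X₀ ⊆ S → S = X₀ := by
      intro S hS hXS
      have h1 : ple (κ X₀) (κ S) = true := hmono X₀ S hXS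
      rw [hκS X₀ hX₀M, hκS S (h𝒮M S hS), hX₀c] at h1
      have hS11 : ι S = 11 := hT11 (ι S, ι (M \ S)) (htypes S hS) h1
      exact (Finset.eq_of_subset_of_card_le hXS (hX₀max S (Finset.mem_filter.2 ⟨hS, hS11⟩))).symm
    -- members containing the `ab`-component join `a–b`, hence have cell `ab|cy`
    have hab₀ : (openGraph (↑(C ∪ X₀) : Set (Sym2 (Fin n)))).Reachable a b :=
      (hab_iff X₀).2 (by rw [hX₀c]; decide)
    refine exists_odd_good_handshake11 a b c y C M ι hι 𝒮 h𝒮M htypes7 X₀ hX₀ hX₀c hmax ?_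
    intro X hXS hAX
    set A₀ : Finset (Sym2 (Fin n)) :=
      X₀.filter (fun e => ∀ v, v ∈ e → (openGraph (↑(C ∪ X₀) : Set (Sym2 (Fin n)))).Reachable a v) with hA₀
    have hA₀def : ∀ e ∈ X₀, (∀ v ∈ e, (openGraph (↑(C ∪ X₀) : Set (Sym2 (Fin n)))).Reachable a v) → e ∈ A₀ :=
      fun e he h => Finset.mem_filter.2 ⟨he, fun v hv => h v hv⟩
    have hA₀X : A₀ ⊆ X := fun e he => hAX e (Finset.mem_filter.1 he).1 (Finset.mem_filter.1 he).2
    have habA : (openGraph (↑(C ∪ A₀) : Set (Sym2 (Fin n)))).Reachable a b :=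
      reachable_ab_of_component C X₀ A₀ a b hA₀def hab₀
    have habX : (openGraph (↑(C ∪ X) : Set (Sym2 (Fin n)))).Reachable a b :=
      reachable_mono_finset (Finset.union_subset_union (subset_refl C) hA₀X) habA
    have hpp := (hab_iff X).1 habX
    by_contra hne11
    have hq := hTnoab (ι X, ι (M \ X)) (htypes X hXS)
    have hnoab : pp (ι X) 0 1 = false := by
      have hmem := htypes X hXS
      simp only [Finset.mem_insert, Finset.mem_singleton, Prod.mk.injEq] at hmem
      rcases hmem with h | h | h | h
      · rw [h.1]; decide
      · exact absurd h.1 hne11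
      · exact absurd h.1 hne11
      · rw [h.1]; decide
    rw [hnoab] at hpp
    exact absurd hpp (by decide)
  · -- no cell-`ab|cy` member: only `Pc`- and `K4s`-sides
    have hall : ∀ S ∈ 𝒮, (ι S = 5 ∧ ι (M \ S) = 7) ∨ (ι S = 8 ∧ ι (M \ S) = 1) := by
      intro S hS
      have hmem := htypes S hS
      simp only [Finset.mem_insert, Finset.mem_singleton, Prod.mk.injEq] at hmem
      rcases hmem with h | h | h | h
      · exact Or.inl h
      · exact absurd ⟨S, hS, h.1⟩ hX
      · exact absurd ⟨S, hS, h.1⟩ hX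
      · exact Or.inr h
    -- a private compatible member of maximal size among those of a given type
    have hcert : ∀ (h₀ l₀ : Fin 15), (∃ S ∈ 𝒮, ι S = h₀ ∧ ι (M \ S) = l₀) →
        (∀ S ∈ 𝒮, upAC (ι S) l₀ = true ∧ downBot (ι (M \ S)) h₀ = true) →
        (∀ S ∈ 𝒮, ple h₀ (ι S) = true → ple (ι (M \ S)) l₀ = true → ι S = h₀ ∧ ι (M \ S) = l₀) →
        ∃ T ∈ goods κ, Odd #(𝒮.filter (fun S => S ⊆ T)) := by
      intro h₀ l₀ hex hcompat hcont
      obtain ⟨S₀, hS₀f, hS₀max⟩ := Finset.exists_max_image (𝒮.filter (fun S => ι S = h₀ ∧ ι (M \ S) = l₀)) Finset.card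
        (by obtain ⟨S, hS, h1, h2⟩ := hex; exact ⟨S, Finset.mem_filter.2 ⟨hS, h1, h2⟩⟩)
      have hS₀ : S₀ ∈ 𝒮 := (Finset.mem_filter.1 hS₀f).1
      have hS₀t : ι S₀ = h₀ ∧ ι (M \ S₀) = l₀ := (Finset.mem_filter.1 hS₀f).2
      have hS₀M : S₀ ⊆ M := h𝒮M S₀ hS₀
      refine exists_odd_good_of_subkernel κ hmono 𝒮 (subset_refl S₀) ?_ ?_
      · intro S hS
        rw [hκSc S₀, hS₀t.2, hκS S₀ hS₀M, hS₀t.1, hκS S (h𝒮M S hS), hκSc S]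
        exact hcompat S hS
      · have hEq : 𝒮.filter (fun S => S₀ ⊆ S) = {S₀} := by
          ext S
          simp only [Finset.mem_filter, Finset.mem_singleton]
          constructor
          · rintro ⟨hS, hsub⟩
            have h1 : ple (ι S₀) (ι S) = true := by
              have h := hmono S₀ S hsub; rwa [hκS S₀ hS₀M, hκS S (h𝒮M S hS)] at h
            have h2 : ple (ι (M \ S)) (ι (M \ S₀)) = true := by
              have h := hmono Sᶜ S₀ᶜ (Finset.compl_subset_compl.2 hsub); rwa [hκSc S, hκSc S₀] at h
            rw [hS₀t.1] at h1; rw [hS₀t.2] at h2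
            have hSt := hcont S hS h1 h2
            exact (Finset.eq_of_subset_of_card_le hsub (hS₀max S (Finset.mem_filter.2 ⟨hS, hSt⟩))).symm
          · rintro rfl; exact ⟨hS₀, subset_refl _⟩
        rw [hEq, Finset.card_singleton]; exact odd_one
    by_cases hc : ∃ S ∈ 𝒮, ι S = 5 ∧ ι (M \ S) = 7
    · -- an `a→c` lobe of maximal size
      refine hcert 5 7 hc (fun S hS => ?_) (fun S hS h1 h2 => ?_)
      · rcases hall S hS with h | h
        · rw [h.1, h.2]; exact hTcompat (5, 7) (by decide)
        · rw [h.1, h.2]; exact hTcompat (8, 1) (by decide)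
      · rcases hall S hS with h | h
        · exact h
        · exfalso; rw [h.1] at h1; exact absurd h1 (by decide)
    · -- only `K4s`-sides
      have hall' : ∀ S ∈ 𝒮, ι S = 8 ∧ ι (M \ S) = 1 := by
        intro S hS
        rcases hall S hS with h | h
        · exact absurd ⟨S, hS, h⟩ hc
        · exact h
      obtain ⟨S₁, hS₁⟩ := hne
      refine hcert 8 1 ⟨S₁, hS₁, hall' S₁ hS₁⟩ (fun S hS => ?_) (fun S hS _ _ => hall' S hS)
      rw [(hall' S hS).1, (hall' S hS).2]; exact hT4s

end TwoCopyMono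

end Summit.CriticalPhenomena.PercolationContinuityZ3.Theorems
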